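import Mathlib.Analysis.InnerProductSpace.PiL2
import Mathlib.Analysis.Matrix.PosDef
import Mathlib.Analysis.Normed.Module.FiniteDimension
import Mathlib.Topology.MetricSpace.ProperSpace
import HarnessLib

/-!
# Convex integration in 2-D: the relaxed set `𝒰` (Definition 4.2 of Chiodaroli–De Lellis–Kreml)

Topic `Analysis/FluidPDE`. Second layer of the decomposition of
`Literature.Analysis.FluidPDE.ConvexIntegration.ConvexIntegrationLemma2D` (Chiodaroli–De Lellis–Kreml,
CPAM 68 (2015), Lemma 3.7): the finite-dimensional geometry of the state space
`ℝ² × Sym₀(2)` in which the convex-integration scheme runs.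

## Reduced coordinates

A symmetric trace-free `2 × 2` matrix is `[[q₀, q₁], [q₁, -q₀]]`; we use `q = (q₀, q₁) ∈ ℝ²` as
coordinates on `Sym₀(2)` (`symMat q`), so the state space `ℝ² × Sym₀(2)` of CDK §4 is
`EuclideanSpace ℝ (Fin 2) × EuclideanSpace ℝ (Fin 2)` with points `z = (a, q)`.

* `relaxMat C z = (C/2) Id - (a ⊗ a - symMat q)` and its quadratic form `relaxQ C z x = xᵀ (relaxMat C z) x`
  (written out as a polynomial in the coordinates);
* `relaxedSet C = 𝒰` of CDK Definition 4.2: the `(a, q)` with `a ⊗ a - symMat q < (C/2) Id`, i.e.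
  `relaxQ C z x > 0` for `x ≠ 0`; `mem_relaxedSet_iff_posDef` identifies this with
  `Matrix.PosDef (relaxMat C z)`, the form in which the hypothesis of Lemma 3.7 is stated in
  `ConvexIntegrationLemma2D`;
* `mem_relaxedSet_iff_det`: the `2 × 2` criterion `0 < tr = C - |a|²` and `0 < det`; hence
  `isOpen_relaxedSet`, the bounds `|a|² < C`, `|q₀| < C/2`, `|q₁| < C` on `𝒰`, and on the closure:
  `|a|² ≤ C`, and `|a|² = C` forces `symMat q = a ⊗ a - (C/2) Id` (`snd_eq_of_mem_closure`), i.e.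
  `K^co ∩ {|a|² = C} = K` for `K = {(a, a ⊗ a - (C/2) Id) : |a|² = C}` (CDK §4.2, from
  De Lellis–Székelyhidi, Arch. Ration. Mech. Anal. 195 (2010), Lemma 3 (ii)–(iii));
* `rot`, `relaxB`, `relaxQ_add_smul`, `relaxQ_smul`: rotation by `π/2`, the polar form of
  `relaxQ` and its expansion along lines (used by the geometric lemma);
* `IsWaveData C λ a b`, `waveVec λ a b`: the segment directions `p = λ[(a, a ⊗ a) - (b, b ⊗ b)]`,
  `|a| = |b| = √C`, `a ≠ ±b`, `λ > 0` of CDK Prop. 4.1, in reduced coordinates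
  (`symMat_waveVec_snd` checks the `Sym₀(2)`-component).

The geometric lemma itself (CDK Lemma 4.3) is proved in
`ConvexIntegration2DGeometricLemma.lean`.

## References

* E. Chiodaroli, C. De Lellis, O. Kreml, *Global ill-posedness of the isentropic system of gas
  dynamics*, Comm. Pure Appl. Math. 68 (2015) 1157–1190, Def. 4.2, Prop. 4.1, Lemma 4.3, §4.2.
* C. De Lellis, L. Székelyhidi Jr., *On admissibility criteria for weak solutions of the Euler
  equations*, Arch. Ration. Mech. Anal. 195 (2010) 225–260, Lemma 3.
-/

noncomputable section

open Set Metric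

namespace Literature.Analysis.FluidPDE.ConvexIntegration

/-! ### Reduced coordinates on `Sym₀(2)` -/

/-- `symMat q = [[q₀, q₁], [q₁, -q₀]]`: the symmetric trace-free `2 × 2` matrix with reduced
coordinates `q = (q₀, q₁)`; `q ↦ symMat q` is a linear isomorphism `ℝ² ≅ Sym₀(2)`. [folklore] -/
def symMat (q : EuclideanSpace ℝ (Fin 2)) : Matrix (Fin 2) (Fin 2) ℝ :=
  !![q 0, q 1; q 1, -q 0]

/-- Entry `(0,0)` of `symMat q`. [folklore] -/
@[simp] theorem symMat_apply_00 (q : EuclideanSpace ℝ (Fin 2)) : symMat q 0 0 = q 0 := rfl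
/-- Entry `(0,1)` of `symMat q`. [folklore] -/
@[simp] theorem symMat_apply_01 (q : EuclideanSpace ℝ (Fin 2)) : symMat q 0 1 = q 1 := rfl
/-- Entry `(1,0)` of `symMat q`. [folklore] -/
@[simp] theorem symMat_apply_10 (q : EuclideanSpace ℝ (Fin 2)) : symMat q 1 0 = q 1 := rfl
/-- Entry `(1,1)` of `symMat q`. [folklore] -/
@[simp] theorem symMat_apply_11 (q : EuclideanSpace ℝ (Fin 2)) : symMat q 1 1 = -q 0 := rfl

/-- `symMat q` is symmetric. [folklore] -/
theorem symMat_isSymm (q : EuclideanSpace ℝ (Fin 2)) : (symMat q).IsSymm := by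
  ext i j; fin_cases i <;> fin_cases j <;> rfl

/-- `symMat q` is trace-free. [folklore] -/
theorem trace_symMat (q : EuclideanSpace ℝ (Fin 2)) : (symMat q).trace = 0 := by
  simp [Matrix.trace, Fin.sum_univ_two]

/-- Every symmetric trace-free `2 × 2` matrix is `symMat` of its first row. [folklore] -/
theorem symMat_eq_of_isSymm_of_trace {u : Matrix (Fin 2) (Fin 2) ℝ} (hs : u.IsSymm)
    (ht : u.trace = 0) : symMat !₂[u 0 0, u 0 1] = u := by
  have h10 : u 1 0 = u 0 1 := by
    have := congrFun (congrFun hs 0) 1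
    simpa [Matrix.transpose_apply] using this
  have h11 : u 1 1 = -u 0 0 := by
    simp [Matrix.trace, Fin.sum_univ_two] at ht
    linarith
  ext i j; fin_cases i <;> fin_cases j <;> simp [h10, h11]

/-! ### The relaxation matrix, its quadratic form, and the relaxed set `𝒰` -/

/-- The relaxation matrix `(C/2) Id - (a ⊗ a - symMat q)` of the state `z = (a, q)`; the state is
a strict subsolution value iff this matrix is positive definite (CDK 2015, Def. 4.2).
[cite: ChiodaroliDeLellisKreml2015, Def. 4.2] -/
def relaxMat (C : ℝ) (z : EuclideanSpace ℝ (Fin 2) × EuclideanSpace ℝ (Fin 2)) :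
    Matrix (Fin 2) (Fin 2) ℝ :=
  (C / 2) • (1 : Matrix (Fin 2) (Fin 2) ℝ) - (Matrix.vecMulVec z.1 z.1 - symMat z.2)

/-- The quadratic form `x ↦ xᵀ ((C/2) Id - a ⊗ a + symMat q) x` of the relaxation matrix,
written out in coordinates: `(C/2)|x|² - (a · x)² + q₀ (x₀² - x₁²) + 2 q₁ x₀ x₁`.
[cite: ChiodaroliDeLellisKreml2015, Def. 4.2] -/
def relaxQ (C : ℝ) (z : EuclideanSpace ℝ (Fin 2) × EuclideanSpace ℝ (Fin 2))
    (x : EuclideanSpace ℝ (Fin 2)) : ℝ :=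
  C / 2 * (x 0 ^ 2 + x 1 ^ 2) - (z.1 0 * x 0 + z.1 1 * x 1) ^ 2
    + (z.2 0 * (x 0 ^ 2 - x 1 ^ 2) + 2 * z.2 1 * x 0 * x 1)

/-- **The relaxed set `𝒰` (CDK 2015, Definition 4.2)**, in reduced coordinates: the states
`(a, q) ∈ ℝ² × Sym₀(2)` with `a ⊗ a - symMat q < (C/2) Id`, i.e. whose relaxation quadratic
form is positive definite (`mem_relaxedSet_iff_posDef`). It is the interior of the convex hull
of `K = {(a, a ⊗ a - (C/2) Id) : |a|² = C}` (CDK §4.2; De Lellis–Székelyhidi 2010, Lemma 3).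
[cite: ChiodaroliDeLellisKreml2015, Def. 4.2] -/
def relaxedSet (C : ℝ) : Set (EuclideanSpace ℝ (Fin 2) × EuclideanSpace ℝ (Fin 2)) :=
  {z | ∀ x : EuclideanSpace ℝ (Fin 2), x ≠ 0 → 0 < relaxQ C z x}

section Basic

variable {C : ℝ} {z : EuclideanSpace ℝ (Fin 2) × EuclideanSpace ℝ (Fin 2)}

/-- Entries of the relaxation matrix. [cite: ChiodaroliDeLellisKreml2015, Def. 4.2] -/
theorem relaxMat_eq (C : ℝ) (z : EuclideanSpace ℝ (Fin 2) × EuclideanSpace ℝ (Fin 2)) :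
    relaxMat C z = !![C / 2 - z.1 0 ^ 2 + z.2 0, z.2 1 - z.1 0 * z.1 1;
                      z.2 1 - z.1 0 * z.1 1, C / 2 - z.1 1 ^ 2 - z.2 0] := by
  ext i j
  fin_cases i <;> fin_cases j <;>
    simp [relaxMat, Matrix.vecMulVec] <;> ring

/-- The relaxation matrix is symmetric (Hermitian over `ℝ`). [folklore] -/
theorem relaxMat_isHermitian (C : ℝ) (z : EuclideanSpace ℝ (Fin 2) × EuclideanSpace ℝ (Fin 2)) :
    (relaxMat C z).IsHermitian := by
  rw [relaxMat_eq]
  ext i j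
  fin_cases i <;> fin_cases j <;> simp [Matrix.conjTranspose]

/-- `relaxQ` is the quadratic form of `relaxMat`: `relaxQ C z x = xᵀ (relaxMat C z) x`.
[cite: ChiodaroliDeLellisKreml2015, Def. 4.2] -/
theorem relaxQ_eq_dotProduct (C : ℝ) (z : EuclideanSpace ℝ (Fin 2) × EuclideanSpace ℝ (Fin 2))
    (x : Fin 2 → ℝ) :
    relaxQ C z (WithLp.toLp 2 x) = dotProduct x ((relaxMat C z).mulVec x) := by
  rw [relaxMat_eq]
  simp [relaxQ, Matrix.mulVec, dotProduct, Fin.sum_univ_two]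
  ring

/-- **Definition 4.2 as printed.** A state lies in `𝒰` iff its relaxation matrix
`(C/2) Id - (a ⊗ a - symMat q)` is positive definite, i.e. `a ⊗ a - symMat q < (C/2) Id`.
[cite: ChiodaroliDeLellisKreml2015, Def. 4.2] -/
theorem mem_relaxedSet_iff_posDef : z ∈ relaxedSet C ↔ (relaxMat C z).PosDef := by
  constructor
  · intro h
    refine Matrix.PosDef.of_dotProduct_mulVec_pos (relaxMat_isHermitian C z) fun x hx => ?_
    have hx' : WithLp.toLp 2 x ≠ (0 : EuclideanSpace ℝ (Fin 2)) := by
      intro h0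
      apply hx
      have := congrArg WithLp.ofLp h0
      simpa using this
    simpa [relaxQ_eq_dotProduct] using h _ hx'
  · intro h x hx
    have hx' : WithLp.ofLp x ≠ 0 := by
      intro h0; apply hx; simpa using congrArg (WithLp.toLp 2) h0
    have := h.dotProduct_mulVec_pos hx'
    simp only [star_trivial] at this
    rw [← relaxQ_eq_dotProduct] at this
    simpa using this

/-- The norm on `EuclideanSpace ℝ (Fin 2)` in coordinates. [folklore] -/
theorem norm_sq_eq_two (x : EuclideanSpace ℝ (Fin 2)) : ‖x‖ ^ 2 = x 0 ^ 2 + x 1 ^ 2 := by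
  rw [EuclideanSpace.norm_sq_eq]; simp [Fin.sum_univ_two]

/-- A vector of `ℝ²` vanishes iff both coordinates vanish. [folklore] -/
theorem eq_zero_iff_two (x : EuclideanSpace ℝ (Fin 2)) : x = 0 ↔ x 0 = 0 ∧ x 1 = 0 := by
  constructor
  · rintro rfl; simp
  · rintro ⟨h0, h1⟩; ext i; fin_cases i <;> simp [h0, h1]

/-- **`2 × 2` criterion.** `(a, q) ∈ 𝒰` iff the relaxation matrix has positive trace
`C - |a|²` and positive determinant. [folklore] -/
theorem mem_relaxedSet_iff_det : z ∈ relaxedSet C ↔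
    0 < C - (z.1 0 ^ 2 + z.1 1 ^ 2) ∧
    0 < (C / 2 - z.1 0 ^ 2 + z.2 0) * (C / 2 - z.1 1 ^ 2 - z.2 0) - (z.2 1 - z.1 0 * z.1 1) ^ 2 := by
  -- entries `m₁₁, m₁₂, m₂₂` of the relaxation matrix
  set m₁₁ := C / 2 - z.1 0 ^ 2 + z.2 0 with hm₁₁
  set m₂₂ := C / 2 - z.1 1 ^ 2 - z.2 0 with hm₂₂
  set m₁₂ := z.2 1 - z.1 0 * z.1 1 with hm₁₂
  have hQ : ∀ x : EuclideanSpace ℝ (Fin 2),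
      relaxQ C z x = m₁₁ * x 0 ^ 2 + 2 * m₁₂ * x 0 * x 1 + m₂₂ * x 1 ^ 2 := by
    intro x; simp only [relaxQ, hm₁₁, hm₂₂, hm₁₂]; ring
  have htr : C - (z.1 0 ^ 2 + z.1 1 ^ 2) = m₁₁ + m₂₂ := by rw [hm₁₁, hm₂₂]; ring
  rw [htr]
  constructor
  · intro h
    have h1 : 0 < m₁₁ := by
      have := h !₂[1, 0] (by simp)
      rw [hQ] at this; simpa using this
    have h2 : 0 < m₂₂ := by
      have := h !₂[0, 1] (by simp)
      rw [hQ] at this; simpa using this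
    refine ⟨add_pos h1 h2, ?_⟩
    have := h !₂[m₁₂, -m₁₁] (by simp [h1.ne'])
    rw [hQ] at this
    simp only [Matrix.cons_val_zero, Matrix.cons_val_one, Matrix.cons_val_fin_one] at this
    nlinarith
  · rintro ⟨htr', hdet⟩ x hx
    have h1 : 0 < m₁₁ := by nlinarith [sq_nonneg m₁₂, sq_nonneg (m₁₁ - m₂₂)]
    rw [hQ]
    have key : m₁₁ * (m₁₁ * x 0 ^ 2 + 2 * m₁₂ * x 0 * x 1 + m₂₂ * x 1 ^ 2) =
        (m₁₁ * x 0 + m₁₂ * x 1) ^ 2 + (m₁₁ * m₂₂ - m₁₂ ^ 2) * x 1 ^ 2 := by ring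
    by_cases hx1 : x 1 = 0
    · have hx0 : x 0 ≠ 0 := fun h0 => hx ((eq_zero_iff_two x).mpr ⟨h0, hx1⟩)
      have : 0 < x 0 ^ 2 := by positivity
      rw [hx1]
      nlinarith
    · have hpos : 0 < (m₁₁ * m₂₂ - m₁₂ ^ 2) * x 1 ^ 2 := mul_pos hdet (by positivity)
      have hm : 0 < m₁₁ * (m₁₁ * x 0 ^ 2 + 2 * m₁₂ * x 0 * x 1 + m₂₂ * x 1 ^ 2) := by
        rw [key]; nlinarith [sq_nonneg (m₁₁ * x 0 + m₁₂ * x 1)]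
      exact (mul_pos_iff_of_pos_left h1).mp hm

/-- `𝒰` is open. [cite: ChiodaroliDeLellisKreml2015, §4.2] -/
theorem isOpen_relaxedSet (C : ℝ) : IsOpen (relaxedSet C) := by
  have h1 : Continuous fun z : EuclideanSpace ℝ (Fin 2) × EuclideanSpace ℝ (Fin 2) =>
      C - (z.1 0 ^ 2 + z.1 1 ^ 2) := by fun_prop
  have h2 : Continuous fun z : EuclideanSpace ℝ (Fin 2) × EuclideanSpace ℝ (Fin 2) =>
      (C / 2 - z.1 0 ^ 2 + z.2 0) * (C / 2 - z.1 1 ^ 2 - z.2 0) - (z.2 1 - z.1 0 * z.1 1) ^ 2 := by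
    fun_prop
  have : relaxedSet C = {z | 0 < C - (z.1 0 ^ 2 + z.1 1 ^ 2)} ∩
      {z | 0 < (C / 2 - z.1 0 ^ 2 + z.2 0) * (C / 2 - z.1 1 ^ 2 - z.2 0) -
        (z.2 1 - z.1 0 * z.1 1) ^ 2} := by
    ext z; exact mem_relaxedSet_iff_det
  rw [this]
  exact (isOpen_lt continuous_const h1).inter (isOpen_lt continuous_const h2)

/-- On `𝒰` the velocity is subsonic for the constant `C`: `|a|² < C`.
[cite: ChiodaroliDeLellisKreml2015, §4.2] -/
theorem norm_sq_fst_lt (hz : z ∈ relaxedSet C) : ‖z.1‖ ^ 2 < C := by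
  rw [norm_sq_eq_two]; linarith [(mem_relaxedSet_iff_det.mp hz).1]

/-- On `𝒰` the `Sym₀(2)`-component is bounded: `|q₀| < C/2` and `|q₁| < C`.
[cite: ChiodaroliDeLellisKreml2015, §4.2] -/
theorem abs_snd_lt (hz : z ∈ relaxedSet C) : |z.2 0| < C / 2 ∧ |z.2 1| < C := by
  obtain ⟨htr, hdet⟩ := mem_relaxedSet_iff_det.mp hz
  have hd1 : 0 < C / 2 - z.1 0 ^ 2 + z.2 0 := by
    nlinarith [sq_nonneg (z.2 1 - z.1 0 * z.1 1), sq_nonneg (z.1 0 ^ 2 - z.1 1 ^ 2 - 2 * z.2 0)]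
  have hd2 : 0 < C / 2 - z.1 1 ^ 2 - z.2 0 := by
    nlinarith [sq_nonneg (z.2 1 - z.1 0 * z.1 1), sq_nonneg (z.1 0 ^ 2 - z.1 1 ^ 2 - 2 * z.2 0)]
  refine ⟨abs_lt.mpr ⟨by nlinarith [sq_nonneg (z.1 0)], by nlinarith [sq_nonneg (z.1 1)]⟩, ?_⟩
  have h12 : (z.2 1 - z.1 0 * z.1 1) ^ 2 < (C / 2) ^ 2 := by
    nlinarith [sq_nonneg (C / 2 - z.1 0 ^ 2 + z.2 0 - (C / 2 - z.1 1 ^ 2 - z.2 0)),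
      sq_nonneg (z.1 0), sq_nonneg (z.1 1)]
  have hC : 0 < C := by nlinarith [sq_nonneg (z.1 0), sq_nonneg (z.1 1)]
  have h12' : |z.2 1 - z.1 0 * z.1 1| < C / 2 := abs_lt_of_sq_lt_sq h12 (half_pos hC).le
  have hprod : |z.1 0 * z.1 1| < C / 2 := by
    rw [abs_mul]
    nlinarith [sq_nonneg (|z.1 0| - |z.1 1|), sq_abs (z.1 0), sq_abs (z.1 1)]
  calc |z.2 1| = |(z.2 1 - z.1 0 * z.1 1) + z.1 0 * z.1 1| := by ring_nf
    _ ≤ |z.2 1 - z.1 0 * z.1 1| + |z.1 0 * z.1 1| := abs_add_le _ _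
    _ < C / 2 + C / 2 := add_lt_add h12' hprod
    _ = C := by ring

/-- On the closure of `𝒰`: `|a|² ≤ C` and the determinant is non-negative.
[cite: ChiodaroliDeLellisKreml2015, §4.2] -/
theorem det_nonneg_of_mem_closure (hz : z ∈ closure (relaxedSet C)) :
    0 ≤ C - (z.1 0 ^ 2 + z.1 1 ^ 2) ∧
    0 ≤ (C / 2 - z.1 0 ^ 2 + z.2 0) * (C / 2 - z.1 1 ^ 2 - z.2 0) - (z.2 1 - z.1 0 * z.1 1) ^ 2 := by
  have h1 : Continuous fun z : EuclideanSpace ℝ (Fin 2) × EuclideanSpace ℝ (Fin 2) =>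
      C - (z.1 0 ^ 2 + z.1 1 ^ 2) := by fun_prop
  have h2 : Continuous fun z : EuclideanSpace ℝ (Fin 2) × EuclideanSpace ℝ (Fin 2) =>
      (C / 2 - z.1 0 ^ 2 + z.2 0) * (C / 2 - z.1 1 ^ 2 - z.2 0) - (z.2 1 - z.1 0 * z.1 1) ^ 2 := by
    fun_prop
  have hsub : relaxedSet C ⊆ {z | 0 ≤ C - (z.1 0 ^ 2 + z.1 1 ^ 2)} ∩
      {z | 0 ≤ (C / 2 - z.1 0 ^ 2 + z.2 0) * (C / 2 - z.1 1 ^ 2 - z.2 0) -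
        (z.2 1 - z.1 0 * z.1 1) ^ 2} := by
    intro w hw
    obtain ⟨ha, hb⟩ := mem_relaxedSet_iff_det.mp hw
    exact ⟨ha.le, hb.le⟩
  have hclosed : IsClosed ({z : EuclideanSpace ℝ (Fin 2) × EuclideanSpace ℝ (Fin 2) |
      0 ≤ C - (z.1 0 ^ 2 + z.1 1 ^ 2)} ∩
      {z | 0 ≤ (C / 2 - z.1 0 ^ 2 + z.2 0) * (C / 2 - z.1 1 ^ 2 - z.2 0) -
        (z.2 1 - z.1 0 * z.1 1) ^ 2}) :=
    (isClosed_le continuous_const h1).inter (isClosed_le continuous_const h2)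
  exact (closure_minimal hsub hclosed) hz

/-- On the closure of `𝒰` the velocity satisfies `|a|² ≤ C`.
[cite: ChiodaroliDeLellisKreml2015, §4.2] -/
theorem norm_sq_fst_le_of_mem_closure (hz : z ∈ closure (relaxedSet C)) : ‖z.1‖ ^ 2 ≤ C := by
  rw [norm_sq_eq_two]; linarith [(det_nonneg_of_mem_closure hz).1]

/-- **`K^co ∩ {|a|² = C} = K`.** On the closure of `𝒰`, if `|a|² = C` then
`symMat q = a ⊗ a - (C/2) Id`, i.e. `q₀ = (a₀² - a₁²)/2` and `q₁ = a₀ a₁`: the relaxation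
matrix is positive semidefinite with zero trace, hence zero (CDK §4.2; De Lellis–Székelyhidi
2010, Lemma 3). [cite: ChiodaroliDeLellisKreml2015, §4.2] -/
theorem snd_eq_of_mem_closure (hz : z ∈ closure (relaxedSet C)) (ha : ‖z.1‖ ^ 2 = C) :
    z.2 0 = (z.1 0 ^ 2 - z.1 1 ^ 2) / 2 ∧ z.2 1 = z.1 0 * z.1 1 := by
  obtain ⟨-, hdet⟩ := det_nonneg_of_mem_closure hz
  rw [norm_sq_eq_two] at ha
  have hsum : (C / 2 - z.1 0 ^ 2 + z.2 0) + (C / 2 - z.1 1 ^ 2 - z.2 0) = 0 := by linarith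
  have hd1 : C / 2 - z.1 0 ^ 2 + z.2 0 = 0 := by
    nlinarith [sq_nonneg (C / 2 - z.1 0 ^ 2 + z.2 0), sq_nonneg (z.2 1 - z.1 0 * z.1 1)]
  have h12 : z.2 1 - z.1 0 * z.1 1 = 0 := by
    nlinarith [sq_nonneg (C / 2 - z.1 0 ^ 2 + z.2 0), sq_nonneg (z.2 1 - z.1 0 * z.1 1)]
  constructor <;> linarith

end Basic

/-! ### Rotation, polar form, homogeneity -/

section Forms

variable {C : ℝ}

/-- Rotation by `π/2` in `ℝ²`: `rot e = (-e₁, e₀)`. [folklore] -/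
def rot (e : EuclideanSpace ℝ (Fin 2)) : EuclideanSpace ℝ (Fin 2) := !₂[-e 1, e 0]

/-- First coordinate of `rot e`. [folklore] -/
@[simp] theorem rot_apply_zero (e : EuclideanSpace ℝ (Fin 2)) : rot e 0 = -e 1 := by simp [rot]
/-- Second coordinate of `rot e`. [folklore] -/
@[simp] theorem rot_apply_one (e : EuclideanSpace ℝ (Fin 2)) : rot e 1 = e 0 := by simp [rot]

/-- The polar (symmetric bilinear) form of `relaxQ C z`. [folklore] -/
def relaxB (C : ℝ) (z : EuclideanSpace ℝ (Fin 2) × EuclideanSpace ℝ (Fin 2))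
    (x y : EuclideanSpace ℝ (Fin 2)) : ℝ :=
  C / 2 * (x 0 * y 0 + x 1 * y 1) - (z.1 0 * x 0 + z.1 1 * x 1) * (z.1 0 * y 0 + z.1 1 * y 1)
    + (z.2 0 * (x 0 * y 0 - x 1 * y 1) + z.2 1 * (x 0 * y 1 + x 1 * y 0))

/-- Expansion of the quadratic form along a line. [folklore] -/
theorem relaxQ_add_smul (z : EuclideanSpace ℝ (Fin 2) × EuclideanSpace ℝ (Fin 2))
    (x y : EuclideanSpace ℝ (Fin 2)) (t : ℝ) :
    relaxQ C z (x + t • y) = relaxQ C z x + 2 * t * relaxB C z x y + t ^ 2 * relaxQ C z y := by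
  simp only [relaxQ, relaxB, PiLp.add_apply, PiLp.smul_apply, smul_eq_mul]
  ring

/-- `relaxQ` is homogeneous of degree two. [folklore] -/
theorem relaxQ_smul (z : EuclideanSpace ℝ (Fin 2) × EuclideanSpace ℝ (Fin 2)) (c : ℝ)
    (x : EuclideanSpace ℝ (Fin 2)) : relaxQ C z (c • x) = c ^ 2 * relaxQ C z x := by
  simp only [relaxQ, PiLp.smul_apply, smul_eq_mul]
  ring

/-- `relaxQ C z` is continuous. [folklore] -/
theorem continuous_relaxQ (C : ℝ) (z : EuclideanSpace ℝ (Fin 2) × EuclideanSpace ℝ (Fin 2)) :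
    Continuous (relaxQ C z) := by
  unfold relaxQ; fun_prop

/-- A unit vector of `ℝ²` in coordinates. [folklore] -/
theorem sq_add_sq_of_norm_eq_one {e : EuclideanSpace ℝ (Fin 2)} (he : ‖e‖ = 1) :
    e 0 ^ 2 + e 1 ^ 2 = 1 := by
  rw [← norm_sq_eq_two, he, one_pow]

/-- The rotation of a unit vector is a unit vector. [folklore] -/
theorem norm_rot_of_norm_eq_one {e : EuclideanSpace ℝ (Fin 2)} (he : ‖e‖ = 1) : ‖rot e‖ = 1 := by
  have h2 := sq_add_sq_of_norm_eq_one he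
  have : ‖rot e‖ ^ 2 = 1 := by rw [norm_sq_eq_two, rot_apply_zero, rot_apply_one]; nlinarith
  exact (pow_eq_one_iff_of_nonneg (norm_nonneg _) two_ne_zero).mp this

end Forms

/-! ### Plane-wave directions (CDK Prop. 4.1) -/

/-- Data of a segment `σ = [-p, p]` as in CDK Prop. 4.1: `p = λ[(a, a ⊗ a) - (b, b ⊗ b)]` with
`λ > 0`, `|a| = |b| = √C` and `a ≠ ±b`. [cite: ChiodaroliDeLellisKreml2015, Prop. 4.1] -/
structure IsWaveData (C lam : ℝ) (a b : EuclideanSpace ℝ (Fin 2)) : Prop where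
  /-- the scale is positive -/
  pos : 0 < lam
  /-- `|a|² = C` -/
  norm_sq_left : ‖a‖ ^ 2 = C
  /-- `|b|² = C` -/
  norm_sq_right : ‖b‖ ^ 2 = C
  /-- `a ≠ b` -/
  ne : a ≠ b
  /-- `a ≠ -b` -/
  ne_neg : a ≠ -b

/-- The direction `p = λ[(a, a ⊗ a) - (b, b ⊗ b)] ∈ ℝ² × Sym₀(2)` of CDK Prop. 4.1 in reduced
coordinates: velocity part `λ(a - b)`, matrix part `λ(a ⊗ a - b ⊗ b)` whose reduced coordinates
are `(λ(a₀² - b₀²), λ(a₀a₁ - b₀b₁))` (trace-free since `|a| = |b|`; see `symMat_waveVec_snd`).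
[cite: ChiodaroliDeLellisKreml2015, Prop. 4.1] -/
def waveVec (lam : ℝ) (a b : EuclideanSpace ℝ (Fin 2)) :
    EuclideanSpace ℝ (Fin 2) × EuclideanSpace ℝ (Fin 2) :=
  (lam • (a - b), lam • !₂[a 0 ^ 2 - b 0 ^ 2, a 0 * a 1 - b 0 * b 1])

/-- For `|a| = |b|` the `Sym₀(2)`-component of `waveVec λ a b` is the matrix
`λ(a ⊗ a - b ⊗ b)`. [cite: ChiodaroliDeLellisKreml2015, Prop. 4.1] -/
theorem symMat_waveVec_snd {lam : ℝ} {a b : EuclideanSpace ℝ (Fin 2)} (h : ‖a‖ ^ 2 = ‖b‖ ^ 2) :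
    symMat (waveVec lam a b).2 = lam • (Matrix.vecMulVec a a - Matrix.vecMulVec b b) := by
  rw [norm_sq_eq_two, norm_sq_eq_two] at h
  ext i j
  fin_cases i <;> fin_cases j <;> simp [waveVec, Matrix.vecMulVec, -mul_eq_mul_left_iff] <;>
    first | ring1 | linear_combination (-lam) * h

/-- Velocity component of `waveVec`. [cite: ChiodaroliDeLellisKreml2015, Prop. 4.1] -/
@[simp] theorem waveVec_fst (lam : ℝ) (a b : EuclideanSpace ℝ (Fin 2)) :
    (waveVec lam a b).1 = lam • (a - b) := rfl

/-- First reduced coordinate of the matrix component of `waveVec`.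
[cite: ChiodaroliDeLellisKreml2015, Prop. 4.1] -/
@[simp] theorem waveVec_snd_apply_zero (lam : ℝ) (a b : EuclideanSpace ℝ (Fin 2)) :
    (waveVec lam a b).2 0 = lam * (a 0 ^ 2 - b 0 ^ 2) := by simp [waveVec]

/-- Second reduced coordinate of the matrix component of `waveVec`.
[cite: ChiodaroliDeLellisKreml2015, Prop. 4.1] -/
@[simp] theorem waveVec_snd_apply_one (lam : ℝ) (a b : EuclideanSpace ℝ (Fin 2)) :
    (waveVec lam a b).2 1 = lam * (a 0 * a 1 - b 0 * b 1) := by simp [waveVec]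

end Literature.Analysis.FluidPDE.ConvexIntegration

end
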